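import Literature.Probability.Percolation.LongRangeVolumeTailBootstrap
import HarnessLib

/-!
# `Hutchcroft2022_twoPoint_volumeTail` (Hutchcroft 2022, Thm. 1.1 + Cor. 1.4): fact split
# (D-0027 A7 exception, batch libsplit-26)

Split file for the XL named fact `Literature.Probability.Percolation.Hutchcroft2022_twoPoint_volumeTail`
(`LongRangeKernelPercolation.lean`; T. Hutchcroft, *Sharp hierarchical upper bounds on the critical
two-point function for long-range percolation on `ℤ^d`*, J. Math. Phys. 63 (2022), arXiv:2202.07634:
the averaged two-point bound of Thm. 1.1 and the volume-tail bound of Cor. 1.4 on `(0, β_c]`).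

The printed proof has three independent inputs, which are the three CHILDREN of the split, and a
deduction which the tree has PROVED:

* `Hutchcroft2022_thm11_subcritical` — **Theorem 1.1 in its subcritical form** (end of the proof of
  Thm. 1.1, p. 13: "`Σ_{a ∈ Λ_r} ℙ_β(0 ↔ a) ≤ (A₂/(cβ)) r^α` for every `0 < β < β_c` and `r ≥ 1`"),
  the output of the hierarchical renormalisation of §2 (Props. 2.4, 2.7, Lemmas 2.6–2.11; partial
  tree support in `Hierarchical*.lean`, with sharpness `LongRangeSharpness.lean` proved);
* `Hutchcroft2022_cor25_betaBound` — **Corollary 2.5**: `c β_c(J) ≤ β₁(d, α)` for kernels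
  `J ≥ c‖x − y‖^{−d−α}` (from Prop. 2.4 at scale `n = 0`);
* `Hutchcroft2022_thm31_twoGhost` — **Theorem 3.1, the two-ghost inequality** (Hutchcroft 2020/21,
  stated in the paper "in the special case of long-range percolation on `ℤ^d`"), in the subcritical,
  finite-partial-sum form the bootstrap consumes;
* `Hutchcroft2022_twoPoint_volumeTail_holds_of` — the parent from the three children (PROVED here):
  Cor. 1.4 on `(0, β_c)` by the bootstrap `volumeTail_of_twoGhost` (`LongRangeVolumeTailBootstrap.lean`,
  (3.3)–(3.6) proved), then both bounds on `(0, β_c]` by lower semicontinuity in `β`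
  (`Hutchcroft2022_twoPoint_volumeTail.of_subcritical`, `LongRangeKernelPercolationProofs.lean`).

None of the children restates the parent: the first is the two-point half below `β_c` with
un-normalised sums, the second a bound on `β_c`, the third an inequality for a different quantity.

## References

* [Hutchcroft2022] T. Hutchcroft, J. Math. Phys. 63 (2022) (arXiv:2202.07634): Thm. 1.1 and the
  last paragraph of its proof (p. 13), Prop. 2.4, Cor. 2.5 (p. 9), Thm. 3.1 and the proof of Cor. 1.4
  (§3, pp. 14–15).
* [Hutchcroft2021] T. Hutchcroft, *Power-law bounds for critical long-range percolation below the
  upper-critical dimension*, PTRF 181 (2021) (arXiv:2008.11197), Thm. 3.1 / the two-ghost inequality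
  of *The critical two-point function for long-range percolation on the hierarchical lattice*,
  arXiv:2103.17013 — the source of Thm. 3.1.
-/

noncomputable section

namespace Literature.Probability.Percolation

open _root_.MeasureTheory Finset
open Literature.Probability.LatticeModels

/-- **Hutchcroft 2022, Theorem 1.1, subcritical form** — CHILD 1 of the split of
`Hutchcroft2022_twoPoint_volumeTail`. For `d ≥ 1` and `0 < α < d` there is `A₂ = A₂(d, α) > 0` such
that for every symmetric nonnegative translation-invariant integrable kernel `J` on `ℤ^d` with
`J(x,y) ≥ c‖x−y‖_∞^{−d−α}` (`c > 0`) and every `0 < β < β_c(J)`: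
`Σ_{x ∈ Λ_r} ℙ_β(0 ↔ x) ≤ (A₂/(cβ)) r^α` for all `r ≥ 1` (`Λ_r = box d r = [−r, r]^d ∩ ℤ^d`). This
is the displayed conclusion at the end of the proof of Thm. 1.1 (p. 13), from which the printed
statement at `β_c` follows by left-continuity; verbatim the two-point half of the hypothesis of
`Hutchcroft2022_twoPoint_volumeTail.of_subcritical`.
[cite: Hutchcroft2022, Thm. 1.1 and the last paragraph of its proof (p. 13)] -/
def Hutchcroft2022_thm11_subcritical : Prop :=
  ∀ (d : ℕ), 1 ≤ d → ∀ α : ℝ, 0 < α → α < d → ∃ A₂ : ℝ, 0 < A₂ ∧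
    ∀ (J : Sym2 (Site d) → ℝ) (c : ℝ), 0 < c → (∀ e, 0 ≤ J e) →
      IsTranslationInvariantKernel J → IsIntegrableKernel J → HasPowerLowerBound J c α →
      ∀ β : ℝ, 0 < β → β < kernelCriticalBeta J → ∀ r : ℕ, 1 ≤ r →
        ∑ x ∈ box d r, (kernelPercolation J β).real (openConn (0 : Site d) x) ≤
          A₂ / (c * β) * (r : ℝ) ^ α

/-- **Hutchcroft 2022, Corollary 2.5** — CHILD 2 of the split of `Hutchcroft2022_twoPoint_volumeTail`.
"Let `J : ℤ^d × ℤ^d → [0,∞)` be a symmetric, integrable function, let `0 < α < d`, and suppose that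
there exists a positive constant `c` such that `J(x,y) ≥ c‖x−y‖^{−d−α}` for every distinct `x, y`.
Then there exists a constant `β₁ = β₁(d,α)` such that `c β_c ≤ β₁`." Stated for `d ≥ 1` and
translation-invariant kernels (the setting of the parent), with `β₁ > 0` (harmless: enlarge).
[cite: Hutchcroft2022, Cor. 2.5 (p. 9)] -/
def Hutchcroft2022_cor25_betaBound : Prop :=
  ∀ (d : ℕ), 1 ≤ d → ∀ α : ℝ, 0 < α → α < d → ∃ β₁ : ℝ, 0 < β₁ ∧
    ∀ (J : Sym2 (Site d) → ℝ) (c : ℝ), 0 < c → (∀ e, 0 ≤ J e) →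
      IsTranslationInvariantKernel J → IsIntegrableKernel J → HasPowerLowerBound J c α →
      c * kernelCriticalBeta J ≤ β₁

/-- **Hutchcroft 2022, Theorem 3.1 (the two-ghost inequality, long-range form on `ℤ^d`)** —
CHILD 3 of the split of `Hutchcroft2022_twoPoint_volumeTail`. Printed: "Let `J` be a
translation-invariant kernel on `ℤ^d`, let `β ≥ 0`, and suppose that there exist constants
`A < ∞` and `0 ≤ θ < 1/2` such that `ℙ_β(|K_o| ≥ n) ≤ A n^{−θ}` for every `n ≥ 1`. Then
`Σ_{x ∈ ℤ^d} (e^{βJ_x} − 1) ℙ_β(𝒮'_{x,n})² ≤ 40000 A²/((1−2θ)² n^{1+2θ})` for every `n ≥ 1`", where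
`𝒮'_{x,n}` is the event that `0` and `x` lie in distinct clusters each containing at least `n`
vertices, at least one of them finite. Stated here in the (weaker) form the bootstrap of Cor. 1.4
consumes (`volumeTail_of_twoGhost`): a constant `C(d)` in place of `40000`; nonnegative integrable
`J`; `0 < β < β_c(J)`, where every cluster is a.s. finite (sharpness, `LongRangeSharpness.lean`) so
that `𝒮'_{x,n} = {|K(0)| ≥ n} ∩ {|K(x)| ≥ n} ∩ {0 ↮ x}` up to a null set; `A ≥ 1`; and the partial
sums over the boxes `Λ_r` (all terms are nonnegative).
[cite: Hutchcroft2022, Thm. 3.1 (p. 14)] [cite: Hutchcroft2021, Thm. 3.1] -/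
def Hutchcroft2022_thm31_twoGhost : Prop :=
  ∀ (d : ℕ), 1 ≤ d → ∃ C : ℝ, 0 < C ∧
    ∀ (J : Sym2 (Site d) → ℝ), (∀ e, 0 ≤ J e) →
      IsTranslationInvariantKernel J → IsIntegrableKernel J →
      ∀ β : ℝ, 0 < β → β < kernelCriticalBeta J → ∀ (A θ : ℝ), 1 ≤ A → 0 ≤ θ → θ < 1 / 2 →
        (∀ n : ℕ, 1 ≤ n →
          (kernelPercolation J β).real (clusterSizeGe (0 : Site d) n) ≤ A * (n : ℝ) ^ (-θ)) →
        ∀ n : ℕ, 1 ≤ n → ∀ r : ℕ,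
          ∑ x ∈ box d r, (Real.exp (β * J s(0, x)) - 1) *
              (kernelPercolation J β).real
                (clusterSizeGe (0 : Site d) n ∩ clusterSizeGe x n ∩ (openConn (0 : Site d) x)ᶜ) ^ 2 ≤
            C * A ^ 2 / ((1 - 2 * θ) ^ 2 * (n : ℝ) ^ (1 + 2 * θ))

/-- **Assembly of the split (PROVED):** `Hutchcroft2022_twoPoint_volumeTail` from its three
children. For `d, α` take `A₂` (Thm. 1.1), `β₁` (Cor. 2.5) and `C` (Thm. 3.1); the bootstrap
`volumeTail_of_twoGhost` gives Cor. 1.4 on `(0, β_c)` with some `A'`; with `A = max A₂ A'` both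
subcritical bounds hold, and `Hutchcroft2022_twoPoint_volumeTail.of_subcritical` (division by
`|Λ_r| ≥ r^d`, lower semicontinuity at `β_c`) yields the fact on `(0, β_c]`.
[cite: Hutchcroft2022, proofs of Thm. 1.1 (p. 13) and Cor. 1.4 (§3, pp. 14–15)] -/
theorem Hutchcroft2022_twoPoint_volumeTail_holds_of (h₁ : Hutchcroft2022_thm11_subcritical)
    (h₂ : Hutchcroft2022_cor25_betaBound) (h₃ : Hutchcroft2022_thm31_twoGhost) :
    Hutchcroft2022_twoPoint_volumeTail := by
  refine Hutchcroft2022_twoPoint_volumeTail.of_subcritical fun d hd α hα hαd => ?_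
  obtain ⟨A₂, hA₂, H₁⟩ := h₁ d hd α hα hαd
  obtain ⟨β₁, hβ₁, H₂⟩ := h₂ d hd α hα hαd
  obtain ⟨C, hC, H₃⟩ := h₃ d hd
  obtain ⟨A', hA', H⟩ := volumeTail_of_twoGhost hd hα hαd hA₂ hβ₁ hC
  refine ⟨max A₂ A', lt_max_of_lt_left hA₂, fun J c hc hJ0 hT hI hL β hβ hβc => ⟨?_, ?_⟩⟩
  · intro r hr
    have hcβ : 0 < c * β := mul_pos hc hβ
    calc ∑ x ∈ box d r, (kernelPercolation J β).real (openConn (0 : Site d) x)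
        ≤ A₂ / (c * β) * (r : ℝ) ^ α := H₁ J c hc hJ0 hT hI hL β hβ hβc r hr
      _ ≤ max A₂ A' / (c * β) * (r : ℝ) ^ α := by
          gcongr
          exact le_max_left _ _
  · intro n hn
    have hb1 : ∀ β' : ℝ, 0 < β' → β' < kernelCriticalBeta J → c * β' < β₁ :=
      fun β' _ hβ'c => (mul_lt_mul_of_pos_left hβ'c hc).trans_le (H₂ J c hc hJ0 hT hI hL)
    have key := H J c hc hJ0 hT hI hL
      (fun β' hβ' hβ'c r hr => H₁ J c hc hJ0 hT hI hL β' hβ' hβ'c r hr) hb1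
      (fun β' hβ' hβ'c A θ hA hθ hθ2 htail m hm r => H₃ J hJ0 hT hI β' hβ' hβ'c A θ hA hθ hθ2 htail m hm r)
      β hβ hβc n hn
    have hcβ : 0 < c * β := mul_pos hc hβ
    calc (kernelPercolation J β).real (clusterSizeGe (0 : Site d) n)
        ≤ A' / (c * β) ^ ((d : ℝ) / (2 * d - α)) * (n : ℝ) ^ (-((d : ℝ) - α) / (2 * d)) := key
      _ ≤ max A₂ A' / (c * β) ^ ((d : ℝ) / (2 * d - α)) * (n : ℝ) ^ (-((d : ℝ) - α) / (2 * d)) := by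
          gcongr
          exact le_max_right _ _

/-- Conversely the parent gives back Child 1 with the same constant (restrict to `β < β_c` and
multiply by `|Λ_r| = (2r+1)^d ≤ (3r)^d`, i.e. up to the factor `3^d`): recorded only as the remark
that the first child is not stronger than the parent in any essential way. Here we prove the clean
half: the parent's two-point bound on `(0, β_c]` implies the averaged bound on `(0, β_c)`.
[cite: Hutchcroft2022, Thm. 1.1] -/
theorem Hutchcroft2022_twoPoint_volumeTail.twoPoint_subcritical (h : Hutchcroft2022_twoPoint_volumeTail)
    {d : ℕ} (hd : 1 ≤ d) {α : ℝ} (hα : 0 < α) (hαd : α < d) :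
    ∃ A : ℝ, 0 < A ∧ ∀ (J : Sym2 (Site d) → ℝ) (c : ℝ), 0 < c → (∀ e, 0 ≤ J e) →
      IsTranslationInvariantKernel J → IsIntegrableKernel J → HasPowerLowerBound J c α →
      ∀ β : ℝ, 0 < β → β < kernelCriticalBeta J → ∀ r : ℕ, 1 ≤ r →
        (∑ x ∈ box d r, (kernelPercolation J β).real (openConn (0 : Site d) x)) /
            ((box d r).card : ℝ) ≤ A / (c * β) * (r : ℝ) ^ (-(d : ℝ) + α) := by
  obtain ⟨A, hA, H⟩ := h d hd α hα hαd
  exact ⟨A, hA, fun J c hc hJ0 hT hI hL β hβ hβc r hr => (H J c hc hJ0 hT hI hL β hβ hβc.le).1 r hr⟩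

end Literature.Probability.Percolation

end
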